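import Summits.QuantumFields.YangMills.Theorems.UnitScaleTiltProp7MassiveColumnPointwiseDecay
import HarnessLib

/-!
# Route `UnitScaleTilt`, crux K1 «MinimiserStabilityRegPr» (stmt-QuantumFields-19200), EX face after S45 — **(L3′b)-VALUE FILE V4g: THE POINTWISE EXPONENTIAL DECAY OF
# `G_a f` FOR A GENERAL ONE-BLOCK SOURCE `f`, K-FREE** — print's (3.42) first entry «|(G′(U)λ)(x)| ≤ B₀e^{−δ₀d(y,y′)}|λ| for x ∈ Δ(y), supp λ ⊂ Δ(y′)» for the LOD line's massive site
# propagator `G_a = (Δ^η_{U₀} + aQ″†Q″)⁻¹` with an ARBITRARY source supported in one block (the chair's V4 ✓p762742 `…MassiveColumnPointwiseDecay` is the COLUMN case `f = Q″†(δ_y ⊗ Y)`;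
# px5 g12 LOCATE-hPcol 9923ee3f §3∕§4 and LOCATE-ONEFORM e62c4fbc O2: the `M_u` input of the general-source gradient knit and of the one-form bootstrap)

Cell `ym3-torus` (HUMAN RULING D-0037; rung R3 = SU(2) YM₃ on T³ — NOT d = 4, NOT infinite volume, NOT a mass gap, NOT Clay).  Width seat `ym3-torus-px5` (gen 12).
THEOREMS ONLY (0 `def`, 0 `sorry`); `--supports stmt-QuantumFields-19200 --as helper`; count-neutral.

THE ASSEMBLY is the chair's V4 VERBATIM (weight `W = Π_μ cosh(a·circAbs_μ(x₀ − ·))`, `a := κη`, `κ := min μ ¼`, ✓`rate_window`; data domination `s·λ·W`; the (D-E) bracket per block;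
w5's V3 ✓`norm_apply_le_of_kato_member_weighted_of_letter`), with the three column letters replaced by their general-source twins: (D-E) §1 `norm_blockCut_massiveSolution_le`
(px5 g11 ✓`norm_tail_le_of_massive_eq` + px12 ✓`exists_blockDistanceWeight`, the source vanishing off `B(v)` in place of ✓`adjoint_apply_eq_zero_off_block`), (D-P) §1 `norm_equiv_penalty_solution_le`
(V4a ✓`norm_equiv_penalty_apply_le_blockCut` ∘ (D-E)), and the source letter `‖f(x)‖_{W₂} ≤ F_b` on `B(v)`, `0` off it.
WHAT IS PROVED (ns `Summit.QuantumFields.YangMills.Theorems.Prop7MassiveSolutionPointwiseDecay`; LOD letters `hseq hι hT`, `G hAG` VERBATIM).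
* §1 ★ `norm_blockCut_massiveSolution_le` — `‖toL2S(𝟙_{B(z)}·(toL2S⁻¹(G f)))‖ ≤ e^{−μ(tdist(z,v) − 3)}·8C_P²·‖f‖` for `f` supported in `B(v)`; ★ `norm_equiv_penalty_solution_le` — `‖(a·T(ι(Q″(G f))))(x)‖_{W₂} ≤
  p_B·e^{−μ(tdist(B x, v) − 3)}·8C_P²·‖f‖`.
* §2 ★★★ `norm_equiv_massiveSolution_apply_le_decay` — for `U₀ ∈ RegPr F n K ε₀` (`10⁷L³ε₀ ≤ 1`), the LOD letters, `a > 0`, `μ > 0` in the Agmon window, EVERY `f` supported in the block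
  `B(v)` (`(toL2S⁻¹f)(x) = 0` off `B(v)`) with `‖f(x)‖_{W₂} ≤ F_b`, and every fine `x₀`:
  `‖(G f)(x₀)‖_{W₂} ≤ 14·8e^{3κ}·(F_b + e^{3μ}·p_B·8C_P²‖f‖)·e^{−κ·tdist(B(x₀),v)} + √(3³∕(c₀ℓ³)·8)·√(8e^{3κ+6μ}(2(1+1∕μ))³)·8C_P²‖f‖·e^{−(κ∕2)·tdist(B(x₀),v)}`, `κ = min μ ¼`
  — K-FREE at the pins once `‖f‖ ≤ √(c₀ℓ³)·F_b` (one block) is inserted (`p_B√(c₀ℓ³)`, `√(27∕(c₀ℓ³))·√(c₀ℓ³)` are K-free; cf. V1 ✓`norm_apply_le_of_kato_member_block`).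
HYP-SAT (★★OWNER RULING №42): as V4 ✓p762742 — `RegPr` = the member's class; `hseq hι hT hAG` ⟸ ✓`exists_intertwiner_of_regPr`∕✓`inner_adjoint_comp`∕✓`exists_massive_inverse`; the window
`hδ hwin` at slopes `μη`∕`3μ` = routeR-w4 ✓`window_delta`∕`window_win` shape (K-free `μ(am)`); the source letters are data; nothing eventual; conclusion non-vacuous.
HONEST SCOPE.  Composition of landed rows (the chair's assembly re-run); VALUE row of the SITE propagator only — no gradient, no one-form `G = Δ_a⁻¹`; nothing of the ten EX rows, `hT`, `hGF`,
EX `stub_existenceMinimalOrbit` or the crux is proved here; the Yang–Mills mass gap is NOT proved.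

References: T. Bałaban, CMP **99** (1985) 389–434 [Balaban1985BackgroundPropagators] (Thm 3.1 (3.42) p.397, (3.24) p.394, (3.49) p.399); CMP **95** (1984) 17–40 [Balaban1984PropagatorsI]
(p.36); J. Dodziuk, V. Mathai, Contemp. Math. **398** (2006) [DodziukMathai2006] (§1).
-/

set_option autoImplicit false

noncomputable section

open scoped BigOperators Matrix.Norms.L2Operator InnerProductSpace ComplexConjugate

namespace Summit.QuantumFields.YangMills.Theorems.Prop7MassiveSolutionPointwiseDecay

open Literature.MathematicalPhysics.QuantumFieldTheory.Balaban1983to89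
open T4Continuum BlockAveraging
open BlockAveraging (Idx)
open B7Prop1Explicit (disp)
open B5Eq118OneStroke (iterBlockOf iterBlock mem_iterBlock)
open B10Eq27TorusAxialLog (holT transl)
open B7TransferAnalyticMean (meanCLM)
open B4Sect5Torus (TSite)
open B9SectCLatticeCarrier (shift unshift)
open B4TorusKernel.MultiPeriod (circAbs)
open B9Eq311L2Pairing (WL2)
open B11Eq103H1Complex (SiteL2K)
open B9Eq342CoshWeightSite (weight_site_pos weight_site_centre)
open Summit.QuantumFields.YangMills.Theorems.Prop8Chart (emlIterU)
open Literature.MathematicalPhysics.QuantumFieldTheory.Balaban1983to89.T3ContinuumYM3Torus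
open T3SectALandauChart (eta eta_pos bgUnits)
open T3PrintedRegularMinimiser (RegPr)
open T3PrintedRegularOrbits (sites_eq)
open T3LevelShift (siteShift)
open Summit.QuantumFields.YangMills.Theorems.Prop7SectET3Transport (periodsT3 siteEquiv)
open Summit.QuantumFields.YangMills.Theorems.Prop7SectET3HilbertLetters (W₂ frobEquiv toL2S covLapSite toL2S_apply frobEquiv_symm_apply_apply)
open Summit.QuantumFields.YangMills.Theorems.Prop7LaplaceAFlatLetters (norm_sq_toL2S)
open Summit.QuantumFields.YangMills.Theorems.Prop7BlockBumpExtension (sum_eq_sum_iterBlock)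
open Summit.QuantumFields.YangMills.Theorems.Prop7BlockDistanceWeights (sum_exp_neg_mul_tdist_coarse_le tdist_coarse_comm tdist_coarse_triangle eta_mul_pow_eq_one exists_blockDistanceWeight)
open Summit.QuantumFields.YangMills.Theorems.Prop7MassivePropagatorTail (norm_tail_le_of_massive_eq)
open Summit.QuantumFields.YangMills.Theorems.Prop7MassiveColumnBlockDecay (norm_equiv_penalty_apply_le_blockCut)
open Summit.QuantumFields.YangMills.Theorems.Prop7MemberCoshWeight (weight_supersolution_member exp_blockDist_le_weight)
open Summit.QuantumFields.YangMills.Theorems.Prop7KatoBootstrapMemberDecay (norm_apply_le_of_kato_member_weighted_of_letter sum_range_three_inv)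
open Summit.QuantumFields.YangMills.Theorems.Prop7MassiveColumnPointwiseDecay (rate_window normSq_equiv_eq sum_weighted_normSq_eq_blocks)

variable (F : T3Family) {n K : ℕ} (h : n ≤ K) {c₀ c₁ : ℝ} [Fact (0 < c₀)] [Fact (0 < c₁)]
  {ε₀ : ℝ} (hε₀ : 0 < ε₀) (hε7 : 10 ^ 7 * (F.L : ℝ) ^ 3 * ε₀ ≤ 1)
  (U₀ : GaugeField (F.P K) 0 (Matrix.specialUnitaryGroup (Fin 2) ℂ)) (hreg : RegPr F n K ε₀ U₀)
  (Q'' : SiteL2K ℂ 3 (periodsT3 F K) c₀ W₂ →ₗ[ℂ] (Site (F.P K) (K - n) → Matrix (Fin 2) (Fin 2) ℂ))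
  (hseq : ∀ lam : Site (F.P K) 0 → Matrix (Fin 2) (Fin 2) ℂ, ∃ ns : (j : ℕ) → Site (F.P K) j → Matrix (Fin 2) (Fin 2) ℂ, ns 0 = lam ∧
      (∀ (j : ℕ) (y : Site (F.P K) (j + 1)), ns (j + 1) y = ns j (emb y) - meanCLM (Idx (F.P K)) (Matrix (Fin 2) (Fin 2) ℂ) fun i : Idx (F.P K) =>
        ns j (emb y) - ((holT (emlIterU j (bgUnits F K U₀)) (emb y) (stairWord i.2.1 (off i.1)) : (Matrix (Fin 2) (Fin 2) ℂ)ˣ) : Matrix (Fin 2) (Fin 2) ℂ) *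
          ns j (transl (emb y) (disp (stairWord i.2.1 (off i.1)))) * (((holT (emlIterU j (bgUnits F K U₀)) (emb y) (stairWord i.2.1 (off i.1)))⁻¹ : (Matrix (Fin 2) (Fin 2) ℂ)ˣ) : Matrix (Fin 2) (Fin 2) ℂ)) ∧
      ns (K - n) = Q'' (toL2S F K c₀ lam))
  (ι : (Site (F.P K) (K - n) → Matrix (Fin 2) (Fin 2) ℂ) →ₗ[ℂ] SiteL2K ℂ 3 (periodsT3 F n) c₁ W₂)
  (hι : ∀ c, ι c = toL2S F n c₁ (fun z => c (siteShift (sites_eq F n K h) z)))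
  (T : SiteL2K ℂ 3 (periodsT3 F n) c₁ W₂ →ₗ[ℂ] SiteL2K ℂ 3 (periodsT3 F K) c₀ W₂)
  (hT : ∀ (l : SiteL2K ℂ 3 (periodsT3 F K) c₀ W₂) (f : SiteL2K ℂ 3 (periodsT3 F n) c₁ W₂), ⟪ι (Q'' l), f⟫_ℂ = ⟪l, T f⟫_ℂ)
  {a : ℝ} (ha : 0 < a)

/-! ## §1 (D-E) and (D-P) for a general one-block source -/

include hε₀ hε7 hreg hseq hι hT ha in
/-- ★ **(D-E) THE BLOCK DECAY OF `G_a f` AWAY FROM THE SOURCE BLOCK, GENERAL SOURCE**: for `f` supported in `B(v)` and every coarse `z`,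
`‖toL2S(𝟙_{B(z)}·toL2S⁻¹(G f))‖ ≤ e^{−μ(tdist(z,v) − 3)}·8C_P²·‖f‖` — px5 g11's tail ✓`norm_tail_le_of_massive_eq` with px12's block-distance phase centred at `v` (the source vanishes where the phase
does not, BY SUPPORT — no column structure needed). [cite: Balaban1985BackgroundPropagators, Thm 3.1 (3.46) p.398, (3.49) p.399] -/
theorem norm_blockCut_massiveSolution_le
    (G : SiteL2K ℂ 3 (periodsT3 F K) c₀ W₂ →ₗ[ℂ] SiteL2K ℂ 3 (periodsT3 F K) c₀ W₂)
    (hAG : ∀ f, covLapSite F n K c₀ U₀ (G f) + (a : ℂ) • T (ι (Q'' (G f))) = f)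
    {μ : ℝ} (hμ : 0 ≤ μ) {δ₁ : ℝ} (hδ₁ : 0 ≤ δ₁)
    (hδ : 3 * ((eta F n K)⁻¹) ^ 2 * (Real.exp (μ * eta F n K) - 1) ^ 2 + a * ((25 / 8) * (c₁ * ((((F.P K).L : ℝ) ^ (F.P K).d) ^ (K - n))⁻¹ / c₀)) * (Real.exp (3 * μ) - 1) ^ 2 ≤ δ₁ ^ 2)
    (hwin : Real.sqrt (max 2 (16 * c₀ * ((F.L : ℝ) ^ (K - n)) ^ 3 / (a * c₁))) * δ₁ ≤ 1 / 10)
    (f : SiteL2K ℂ 3 (periodsT3 F K) c₀ W₂) (v : Site (F.P K) (K - n)) (hfv : ∀ x, iterBlockOf (K - n) x ≠ v → (toL2S F K c₀).symm f x = 0)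
    (z : Site (F.P K) (K - n)) :
    ‖toL2S F K c₀ (fun x => if iterBlockOf (K - n) x = z then (toL2S F K c₀).symm (G f) x else 0)‖
      ≤ Real.exp (-(μ * ((Site.tdist z v : ℝ) - 3))) * (8 * Real.sqrt (max 2 (16 * c₀ * ((F.L : ℝ) ^ (K - n)) ^ 3 / (a * c₁))) ^ 2) * ‖f‖ := by
  classical
  obtain ⟨φ, φc, -, hφb, -, hφc, hφy, hφz⟩ := exists_blockDistanceWeight F (n := n) (K := K) h v hμ
  set u : Site (F.P K) 0 → Matrix (Fin 2) (Fin 2) ℂ := (toL2S F K c₀).symm (G f) with hu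
  set f' : Site (F.P K) 0 → Matrix (Fin 2) (Fin 2) ℂ := (toL2S F K c₀).symm f with hf'
  have hAu : covLapSite F n K c₀ U₀ (toL2S F K c₀ u) + (a : ℂ) • T (ι (Q'' (toL2S F K c₀ u))) = toL2S F K c₀ f' := by
    rw [hu, hf', LinearEquiv.apply_symm_apply, LinearEquiv.apply_symm_apply]; exact hAG _
  have hφf : ∀ x, f' x ≠ 0 → φ x = 0 := by
    intro x hx
    apply hφy x
    by_contra hne
    exact hx (by rw [hf']; exact hfv x hne)
  set χt : Site (F.P K) 0 → ℝ := fun x => if iterBlockOf (K - n) x = z then 0 else 1 with hχt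
  have hχt1 : ∀ x, |1 - χt x| ≤ 1 := by
    intro x; rw [hχt]; dsimp only; split_ifs <;> norm_num
  have hR : ∀ x, χt x ≠ 1 → μ * ((Site.tdist z v : ℝ) - 3) ≤ φ x := by
    intro x hx
    have hxz : iterBlockOf (K - n) x = z := by
      by_contra hne; apply hx; rw [hχt]; dsimp only; rw [if_neg hne]
    exact hφz z x hxz
  have htail := norm_tail_le_of_massive_eq F h hε₀ hε7 U₀ hreg Q'' hseq ι hι T hT ha φ φc (by positivity) hφb hφc hδ₁ hδ hwin χt hχt1 hR u f' hφf hAu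
  have hcut : (fun x => (1 - χt x) • u x) = fun x => if iterBlockOf (K - n) x = z then u x else 0 := by
    funext x; rw [hχt]; dsimp only; split_ifs <;> simp
  rw [hcut] at htail
  have hff : toL2S F K c₀ f' = f := by rw [hf', LinearEquiv.apply_symm_apply]
  rw [hff] at htail
  exact htail

include hε₀ hε7 hreg hseq hι hT ha in
/-- ★ **(D-P) THE PENALTY ALONG `G_a f` DECAYS AWAY FROM THE SOURCE BLOCK, GENERAL SOURCE**: V4a's block-local penalty row ✓`norm_equiv_penalty_apply_le_blockCut` at `u := G f`, then (D-E) at the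
block of `x`. [cite: Balaban1985BackgroundPropagators, (3.24) p.394, (3.49) p.399] -/
theorem norm_equiv_penalty_solution_le
    (G : SiteL2K ℂ 3 (periodsT3 F K) c₀ W₂ →ₗ[ℂ] SiteL2K ℂ 3 (periodsT3 F K) c₀ W₂)
    (hAG : ∀ f, covLapSite F n K c₀ U₀ (G f) + (a : ℂ) • T (ι (Q'' (G f))) = f)
    {μ : ℝ} (hμ : 0 ≤ μ) {δ₁ : ℝ} (hδ₁ : 0 ≤ δ₁)
    (hδ : 3 * ((eta F n K)⁻¹) ^ 2 * (Real.exp (μ * eta F n K) - 1) ^ 2 + a * ((25 / 8) * (c₁ * ((((F.P K).L : ℝ) ^ (F.P K).d) ^ (K - n))⁻¹ / c₀)) * (Real.exp (3 * μ) - 1) ^ 2 ≤ δ₁ ^ 2)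
    (hwin : Real.sqrt (max 2 (16 * c₀ * ((F.L : ℝ) ^ (K - n)) ^ 3 / (a * c₁))) * δ₁ ≤ 1 / 10)
    (f : SiteL2K ℂ 3 (periodsT3 F K) c₀ W₂) (v : Site (F.P K) (K - n)) (hfv : ∀ x, iterBlockOf (K - n) x ≠ v → (toL2S F K c₀).symm f x = 0)
    (x : Site (F.P K) 0) :
    ‖WL2.equiv ℂ _ W₂ ((a : ℂ) • T (ι (Q'' (G f)))) (siteEquiv F K x)‖
      ≤ a * ((5 / 4) * Real.sqrt (2 * c₁) * ((((F.P K).L : ℝ) ^ (F.P K).d) ^ (K - n))⁻¹ / c₀) *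
          Real.sqrt ((25 / 8) * (c₁ * ((((F.P K).L : ℝ) ^ (F.P K).d) ^ (K - n))⁻¹ / c₀)) *
          (Real.exp (-(μ * ((Site.tdist (iterBlockOf (K - n) x) v : ℝ) - 3))) * (8 * Real.sqrt (max 2 (16 * c₀ * ((F.L : ℝ) ^ (K - n)) ^ 3 / (a * c₁))) ^ 2) * ‖f‖) := by
  have h1 := norm_equiv_penalty_apply_le_blockCut F h hε₀ hε7 U₀ hreg Q'' hseq ι hι T hT ha (G f) x
  have h2 := norm_blockCut_massiveSolution_le F h hε₀ hε7 U₀ hreg Q'' hseq ι hι T hT ha G hAG hμ hδ₁ hδ hwin f v hfv (iterBlockOf (K - n) x)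
  have hA0 : 0 ≤ a * ((5 / 4) * Real.sqrt (2 * c₁) * ((((F.P K).L : ℝ) ^ (F.P K).d) ^ (K - n))⁻¹ / c₀) *
      Real.sqrt ((25 / 8) * (c₁ * ((((F.P K).L : ℝ) ^ (F.P K).d) ^ (K - n))⁻¹ / c₀)) := by
    have := (F.P K).L_pos; have : (0:ℝ) < c₀ := Fact.out; positivity
  exact h1.trans (mul_le_mul_of_nonneg_left h2 hA0)

/-! ## §2 The pointwise decay of `G_a f` -/

include hε₀ hε7 hreg hseq hι hT ha in
set_option maxHeartbeats 400000 in
-- hb: the 230-line assembly elaborates between 100k and 200k heartbeats (the chair's V4 twin); decl-local budget per the cell heartbeat rule (README), ≥ 2× margin.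
/-- ★★★ **THE POINTWISE EXPONENTIAL DECAY OF `G_a f` AT A CURVED BACKGROUND FOR A GENERAL ONE-BLOCK SOURCE, K-FREE** (print's (3.42) first entry WITH `e^{−δ₀d}`, any `λ` with
`supp λ ⊂ Δ(y′)`): `‖(G f)(x₀)‖_{W₂} ≤ B₁′·e^{−κ·d} + B₂′·e^{−(κ∕2)·d}`, `d = tdist(B(x₀), v)`, `κ = min μ ¼`, `B₁′ = 14·8e^{3κ}(F_b + e^{3μ}p_B·8C_P²‖f‖)`,
`B₂′ = √(3³∕(c₀ℓ³)·8)·√(8e^{3κ+6μ}(2(1+1∕μ))³)·8C_P²‖f‖` — the chair's V4 assembly with §1's general-source letters. [cite: Balaban1985BackgroundPropagators, Thm 3.1 (3.42) p.397, (3.24) p.394, (3.49) p.399; Balaban1984PropagatorsI, p.36; DodziukMathai2006, §1] -/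
theorem norm_equiv_massiveSolution_apply_le_decay
    (G : SiteL2K ℂ 3 (periodsT3 F K) c₀ W₂ →ₗ[ℂ] SiteL2K ℂ 3 (periodsT3 F K) c₀ W₂)
    (hAG : ∀ f, covLapSite F n K c₀ U₀ (G f) + (a : ℂ) • T (ι (Q'' (G f))) = f)
    {μ : ℝ} (hμ : 0 < μ) {δ₁ : ℝ} (hδ₁ : 0 ≤ δ₁)
    (hδ : 3 * ((eta F n K)⁻¹) ^ 2 * (Real.exp (μ * eta F n K) - 1) ^ 2 + a * ((25 / 8) * (c₁ * ((((F.P K).L : ℝ) ^ (F.P K).d) ^ (K - n))⁻¹ / c₀)) * (Real.exp (3 * μ) - 1) ^ 2 ≤ δ₁ ^ 2)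
    (hwin : Real.sqrt (max 2 (16 * c₀ * ((F.L : ℝ) ^ (K - n)) ^ 3 / (a * c₁))) * δ₁ ≤ 1 / 10)
    (f : SiteL2K ℂ 3 (periodsT3 F K) c₀ W₂) (v : Site (F.P K) (K - n)) (hfv : ∀ x, iterBlockOf (K - n) x ≠ v → (toL2S F K c₀).symm f x = 0)
    {Fb : ℝ} (hFb : ∀ x : Site (F.P K) 0, ‖WL2.equiv ℂ _ W₂ f (siteEquiv F K x)‖ ≤ Fb) (x₀ : Site (F.P K) 0) :
    ‖WL2.equiv ℂ _ W₂ (G f) (siteEquiv F K x₀)‖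
      ≤ (14 * (8 * Real.exp (3 * min μ (1 / 4)) * (Fb + Real.exp (3 * μ) * ((a * ((5 / 4) * Real.sqrt (2 * c₁) * ((((F.P K).L : ℝ) ^ (F.P K).d) ^ (K - n))⁻¹ / c₀) * Real.sqrt ((25 / 8) * (c₁ * ((((F.P K).L : ℝ) ^ (F.P K).d) ^ (K - n))⁻¹ / c₀))) * ((8 * Real.sqrt (max 2 (16 * c₀ * ((F.L : ℝ) ^ (K - n)) ^ 3 / (a * c₁))) ^ 2) * ‖f‖)))))
            * Real.exp (-(min μ (1 / 4) * (Site.tdist (iterBlockOf (K - n) x₀) v : ℝ)))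
          + (Real.sqrt (3 ^ 3 / (c₀ * ((F.L : ℝ) ^ (K - n)) ^ 3) * 8) *
              (Real.sqrt (8 * Real.exp (3 * min μ (1 / 4)) * Real.exp (6 * μ) * (2 * (1 + 1 / μ)) ^ 3) * ((8 * Real.sqrt (max 2 (16 * c₀ * ((F.L : ℝ) ^ (K - n)) ^ 3 / (a * c₁))) ^ 2) * ‖f‖)))
            * Real.exp (-(min μ (1 / 4) / 2 * (Site.tdist (iterBlockOf (K - n) x₀) v : ℝ))) := by
  classical
  have hc₀ : 0 < c₀ := Fact.out
  have hc₁ : 0 < c₁ := Fact.out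
  have hη : 0 < eta F n K := eta_pos F n K
  have hLP := (F.P K).L_pos
  -- the rate (obtained BEFORE the abbreviations, so that `set` rewrites it)
  obtain ⟨haw0, haw1, hlam⟩ := rate_window F (n := n) (K := K) hμ
  -- (D-E) per block, (D-P) pointwise along the column (V4a), and the source size (V2b) — BEFORE the abbreviations, so that `set` rewrites them
  have hDE := fun z => norm_blockCut_massiveSolution_le F h hε₀ hε7 U₀ hreg Q'' hseq ι hι T hT ha G hAG hμ.le hδ₁ hδ hwin f v hfv z
  have hDP := fun x => norm_equiv_penalty_solution_le F h hε₀ hε7 U₀ hreg Q'' hseq ι hι T hT ha G hAG hμ.le hδ₁ hδ hwin f v hfv x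
  set κ : ℝ := min μ (1 / 4) with hκ
  have hκ0 : 0 < κ := by rw [hκ]; exact lt_min hμ (by norm_num)
  have hκμ : κ ≤ μ := by rw [hκ]; exact min_le_left _ _
  set aw : ℝ := κ * eta F n K with haw
  set lam : ℝ := 1 - 2 * (3 : ℕ) * (eta F n K)⁻¹ ^ 2 * (Real.cosh aw - 1) with hlam_def
  have hlam0 : 0 < lam := lt_of_lt_of_le (by norm_num) hlam
  have hκℓ : aw * (F.L : ℝ) ^ (K - n) = κ := by rw [haw, mul_assoc, eta_mul_pow_eq_one F (n := n) (K := K), mul_one]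
  -- letters
  set ℓv : ℝ := ((((F.P K).L : ℝ) ^ (F.P K).d) ^ (K - n))⁻¹ with hℓv
  set sv : ℝ := Real.sqrt ((25 / 8) * (c₁ * ℓv / c₀)) with hsv
  set pB : ℝ := a * ((5 / 4) * Real.sqrt (2 * c₁) * ℓv / c₀) * sv with hpB
  set CP2 : ℝ := Real.sqrt (max 2 (16 * c₀ * ((F.L : ℝ) ^ (K - n)) ^ 3 / (a * c₁))) ^ 2 with hCP2
  set Cf : ℝ := (8 * CP2) * ‖f‖ with hCf
  have hℓv0 : 0 < ℓv := by rw [hℓv]; positivity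
  have hFb0 : 0 ≤ Fb := (norm_nonneg _).trans (hFb x₀)
  have hsv0 : 0 ≤ sv := Real.sqrt_nonneg _
  have hpB0 : 0 ≤ pB := by rw [hpB]; positivity
  have hCf0 : 0 ≤ Cf := by rw [hCf]; positivity
  clear_value κ aw lam ℓv sv pB CP2 Cf
  -- the distance
  set d₀ : ℝ := (Site.tdist (iterBlockOf (K - n) x₀) v : ℝ) with hd₀
  -- the solution and its penalty
  set u : SiteL2K ℂ 3 (periodsT3 F K) c₀ W₂ := G f with hu
  set q : SiteL2K ℂ 3 (periodsT3 F K) c₀ W₂ := (a : ℂ) • T (ι (Q'' u)) with hq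
  have hueq : covLapSite F n K c₀ U₀ u = f - q := by
    rw [eq_sub_iff_add_eq, hq, hu]; exact hAG f
  -- the weight centred at `x₀` (opaque after this block: only its four letters are kept)
  set x₀t : TSite 3 (periodsT3 F K) := siteEquiv F K x₀ with hx₀t
  obtain ⟨W, hWpos, hWx₀, hsup, hWdom⟩ : ∃ W : TSite 3 (periodsT3 F K) → ℝ, (∀ xt, 0 < W xt) ∧ W x₀t = 1 ∧
      (∀ yt, lam * W yt ≤ ∑ j : Fin 3 ⊕ Fin 3, (eta F n K)⁻¹ ^ 2 * (W yt - W (Sum.elim (fun ν => unshift ν yt) (fun ν => shift ν yt) j)) + 1 * W yt) ∧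
      (∀ x : Site (F.P K) 0, (1 / 8) * Real.exp (-(3 * κ)) * Real.exp (κ * (Site.tdist (iterBlockOf (K - n) x₀) (iterBlockOf (K - n) x) : ℝ)) ≤ W (siteEquiv F K x)) := by
    refine ⟨fun xt => ∏ m' : Fin 3, Real.cosh (aw * (circAbs (periodsT3 F K m') (((((x₀t m' : ℕ) : ZMod (periodsT3 F K m')) - ((xt m' : ℕ) : ZMod (periodsT3 F K m'))).val : ℕ) : ℤ) : ℝ)),
      fun xt => weight_site_pos (periodsT3 F K) aw x₀t xt, weight_site_centre (periodsT3 F K) aw x₀t,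
      fun yt => by rw [hlam_def]; exact weight_supersolution_member F n K aw x₀t yt, fun x => ?_⟩
    have hx := exp_blockDist_le_weight F n K h haw0.le x₀ x
    rw [hκℓ] at hx
    rw [hx₀t]
    exact hx
  -- the data constant
  set s : ℝ := 8 * Real.exp (3 * κ) * (Fb + Real.exp (3 * μ) * (pB * Cf)) * Real.exp (-(κ * d₀)) / lam with hs
  have hs0 : 0 ≤ s := by rw [hs]; positivity
  -- data domination
  have hdata : ∀ xt, ‖WL2.equiv ℂ _ W₂ f xt‖ + ‖WL2.equiv ℂ _ W₂ q xt‖ ≤ s * (lam * W xt) := by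
    intro xt
    obtain ⟨x, rfl⟩ : ∃ x, xt = siteEquiv F K x := ⟨(siteEquiv F K).symm xt, ((siteEquiv F K).apply_symm_apply xt).symm⟩
    have hWx := hWdom x
    have hWx0 := hWpos (siteEquiv F K x)
    set dz : ℝ := (Site.tdist (iterBlockOf (K - n) x₀) (iterBlockOf (K - n) x) : ℝ) with hdz
    set dy : ℝ := (Site.tdist (iterBlockOf (K - n) x) v : ℝ) with hdy
    -- triangle: `d₀ ≤ dz + dy`
    have htri : d₀ ≤ dz + dy := tdist_coarse_triangle F (iterBlockOf (K - n) x₀) (iterBlockOf (K - n) x) v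
    -- `e^{κ dz} ≤ 8e^{3κ} W`
    have hWx' : Real.exp (κ * dz) ≤ 8 * Real.exp (3 * κ) * W (siteEquiv F K x) := by
      have h8 : Real.exp (κ * dz) = 8 * Real.exp (3 * κ) * ((1 / 8) * Real.exp (-(3 * κ)) * Real.exp (κ * dz)) := by
        rw [Real.exp_neg]; field_simp
      rw [h8]; exact mul_le_mul_of_nonneg_left hWx (by positivity)
    -- the source: `‖f‖ ≤ F_b·𝟙[B x = v]`
    have hfx : ‖WL2.equiv ℂ _ W₂ f (siteEquiv F K x)‖ ≤ Fb * Real.exp (-(κ * d₀)) * Real.exp (κ * dz) := by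
      by_cases hxy : iterBlockOf (K - n) x = v
      · have h1 := hFb x
        have hd : dz = d₀ := by rw [hdz, hd₀, hxy]
        rw [hd, mul_assoc Fb, ← Real.exp_add, neg_add_cancel, Real.exp_zero, mul_one]
        exact h1
      · have h0 : WL2.equiv ℂ _ W₂ f (siteEquiv F K x) = 0 := by
          have hz := hfv x hxy
          have : f = toL2S F K c₀ ((toL2S F K c₀).symm f) := ((toL2S F K c₀).apply_symm_apply f).symm
          rw [this, toL2S_apply, Equiv.symm_apply_apply, hz, map_zero]
        rw [h0, norm_zero]; positivity
    -- the penalty: `‖q‖ ≤ pB·Cf·e^{3μ}·e^{−κ d₀}·e^{κ dz}`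
    have hqx : ‖WL2.equiv ℂ _ W₂ q (siteEquiv F K x)‖ ≤ Real.exp (3 * μ) * (pB * Cf) * Real.exp (-(κ * d₀)) * Real.exp (κ * dz) := by
      have h1 := hDP x
      -- `e^{−μ(dy − 3)} ≤ e^{3μ}·e^{−κ d₀}·e^{κ dz}`
      have hexp : Real.exp (-(μ * (dy - 3))) ≤ Real.exp (3 * μ) * Real.exp (-(κ * d₀)) * Real.exp (κ * dz) := by
        rw [← Real.exp_add, ← Real.exp_add, Real.exp_le_exp]
        have hdy0 : 0 ≤ dy := by rw [hdy]; exact Nat.cast_nonneg _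
        have h1 : κ * d₀ ≤ κ * (dz + dy) := mul_le_mul_of_nonneg_left htri hκ0.le
        have h2 : κ * dy ≤ μ * dy := mul_le_mul_of_nonneg_right hκμ hdy0
        linarith only [h1, h2]
      have hrew : pB * (Real.exp (-(μ * (dy - 3))) * (8 * CP2) * ‖f‖)
          = pB * Cf * Real.exp (-(μ * (dy - 3))) := by rw [hCf]; ring
      rw [hrew] at h1
      calc _ ≤ pB * Cf * Real.exp (-(μ * (dy - 3))) := h1
        _ ≤ pB * Cf * (Real.exp (3 * μ) * Real.exp (-(κ * d₀)) * Real.exp (κ * dz)) := mul_le_mul_of_nonneg_left hexp (by positivity)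
        _ = _ := by ring
    -- assemble
    have hsum : ‖WL2.equiv ℂ _ W₂ f (siteEquiv F K x)‖ + ‖WL2.equiv ℂ _ W₂ q (siteEquiv F K x)‖
        ≤ (Fb + Real.exp (3 * μ) * (pB * Cf)) * Real.exp (-(κ * d₀)) * Real.exp (κ * dz) :=
      calc _ ≤ _ := add_le_add hfx hqx
        _ = _ := by ring
    have hfin : (Fb + Real.exp (3 * μ) * (pB * Cf)) * Real.exp (-(κ * d₀)) * Real.exp (κ * dz)
        ≤ (Fb + Real.exp (3 * μ) * (pB * Cf)) * Real.exp (-(κ * d₀)) * (8 * Real.exp (3 * κ) * W (siteEquiv F K x)) :=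
      mul_le_mul_of_nonneg_left hWx' (by positivity)
    have hslam : s * lam = 8 * Real.exp (3 * κ) * (Fb + Real.exp (3 * μ) * (pB * Cf)) * Real.exp (-(κ * d₀)) := by
      rw [hs]; exact div_mul_cancel₀ _ hlam0.ne'
    have hsdef : s * (lam * W (siteEquiv F K x)) = (Fb + Real.exp (3 * μ) * (pB * Cf)) * Real.exp (-(κ * d₀)) * (8 * Real.exp (3 * κ) * W (siteEquiv F K x)) := by
      rw [← mul_assoc, hslam]; ring
    rw [hsdef]
    exact hsum.trans hfin
  -- (D-E) bracket: `Σ c₀‖u‖²∕W ≤ EW²`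
  set EW2 : ℝ := 8 * Real.exp (3 * κ) * Real.exp (6 * μ) * (2 * (1 + 1 / μ)) ^ 3 * Cf ^ 2 * Real.exp (-(κ * d₀)) with hEW2
  have hEW2_0 : 0 ≤ EW2 := by rw [hEW2]; positivity
  have hbracket : ∑ yt, c₀ * ‖WL2.equiv ℂ _ W₂ u yt‖ ^ 2 / W yt ≤ EW2 := by
    set u' : Site (F.P K) 0 → Matrix (Fin 2) (Fin 2) ℂ := (toL2S F K c₀).symm u with hu'
    -- read the sum on the route's sites, then on blocks
    have hreidx : ∑ yt, c₀ * ‖WL2.equiv ℂ _ W₂ u yt‖ ^ 2 / W yt = ∑ x : Site (F.P K) 0, c₀ * ‖WL2.equiv ℂ _ W₂ u (siteEquiv F K x)‖ ^ 2 / W (siteEquiv F K x) :=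
      ((siteEquiv F K).sum_comp (fun yt => c₀ * ‖WL2.equiv ℂ _ W₂ u yt‖ ^ 2 / W yt)).symm
    rw [hreidx]
    have hpt : ∀ x : Site (F.P K) 0, c₀ * ‖WL2.equiv ℂ _ W₂ u (siteEquiv F K x)‖ ^ 2 / W (siteEquiv F K x)
        ≤ (8 * Real.exp (3 * κ) * Real.exp (-(κ * (Site.tdist (iterBlockOf (K - n) x₀) (iterBlockOf (K - n) x) : ℝ)))) * (c₀ * ∑ j : Fin 2, ∑ k : Fin 2, ‖u' x j k‖ ^ 2) := by
      intro x
      rw [normSq_equiv_eq F (c₀ := c₀) u x, ← hu', div_eq_mul_inv]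
      have hWinv : (W (siteEquiv F K x))⁻¹ ≤ 8 * Real.exp (3 * κ) * Real.exp (-(κ * (Site.tdist (iterBlockOf (K - n) x₀) (iterBlockOf (K - n) x) : ℝ))) := by
        have hWx := hWdom x
        have hpos : 0 < (1 / 8) * Real.exp (-(3 * κ)) * Real.exp (κ * (Site.tdist (iterBlockOf (K - n) x₀) (iterBlockOf (K - n) x) : ℝ)) := by positivity
        calc (W (siteEquiv F K x))⁻¹ ≤ ((1 / 8) * Real.exp (-(3 * κ)) * Real.exp (κ * (Site.tdist (iterBlockOf (K - n) x₀) (iterBlockOf (K - n) x) : ℝ)))⁻¹ :=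
              inv_anti₀ hpos hWx
          _ = 8 * Real.exp (3 * κ) * Real.exp (-(κ * (Site.tdist (iterBlockOf (K - n) x₀) (iterBlockOf (K - n) x) : ℝ))) := by
              rw [Real.exp_neg, Real.exp_neg]; field_simp
      calc c₀ * (∑ j : Fin 2, ∑ k : Fin 2, ‖u' x j k‖ ^ 2) * (W (siteEquiv F K x))⁻¹
          ≤ c₀ * (∑ j : Fin 2, ∑ k : Fin 2, ‖u' x j k‖ ^ 2) * (8 * Real.exp (3 * κ) * Real.exp (-(κ * (Site.tdist (iterBlockOf (K - n) x₀) (iterBlockOf (K - n) x) : ℝ)))) :=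
            mul_le_mul_of_nonneg_left hWinv (by positivity)
        _ = _ := by ring
    refine (Finset.sum_le_sum fun x _ => hpt x).trans ?_
    rw [sum_weighted_normSq_eq_blocks F (c₀ := c₀) u' (fun z => 8 * Real.exp (3 * κ) * Real.exp (-(κ * (Site.tdist (iterBlockOf (K - n) x₀) z : ℝ))))]
    -- per block: (D-E)
    have hblk : ∀ z : Site (F.P K) (K - n),
        8 * Real.exp (3 * κ) * Real.exp (-(κ * (Site.tdist (iterBlockOf (K - n) x₀) z : ℝ))) * ‖toL2S F K c₀ (fun x => if iterBlockOf (K - n) x = z then u' x else 0)‖ ^ 2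
          ≤ 8 * Real.exp (3 * κ) * Real.exp (6 * μ) * Cf ^ 2 * Real.exp (-(κ * d₀)) * Real.exp (-(μ * (Site.tdist z v : ℝ))) := by
      intro z
      have h1 := hDE z
      have hC : Real.exp (-(μ * ((Site.tdist z v : ℝ) - 3))) * (8 * CP2) * ‖f‖ = Real.exp (-(μ * ((Site.tdist z v : ℝ) - 3))) * Cf := by
        rw [hCf]; ring
      rw [hC] at h1
      have h0 : 0 ≤ Real.exp (-(μ * ((Site.tdist z v : ℝ) - 3))) * Cf := by positivity
      have h2 : ‖toL2S F K c₀ (fun x => if iterBlockOf (K - n) x = z then u' x else 0)‖ ^ 2 ≤ (Real.exp (-(μ * ((Site.tdist z v : ℝ) - 3))) * Cf) ^ 2 :=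
        pow_le_pow_left₀ (norm_nonneg _) h1 2
      -- exponent bookkeeping: `κ·d(x₀,z) + 2μ·(d(z,y) − 3) ≥ κ d₀ + μ d(z,y) − 6μ`
      have hdz0 : 0 ≤ (Site.tdist (iterBlockOf (K - n) x₀) z : ℝ) := Nat.cast_nonneg _
      have hdzy0 : 0 ≤ (Site.tdist z v : ℝ) := Nat.cast_nonneg _
      have htri : d₀ ≤ (Site.tdist (iterBlockOf (K - n) x₀) z : ℝ) + (Site.tdist z v : ℝ) := tdist_coarse_triangle F _ z v
      have hexp : Real.exp (-(κ * (Site.tdist (iterBlockOf (K - n) x₀) z : ℝ))) * (Real.exp (-(μ * ((Site.tdist z v : ℝ) - 3)))) ^ 2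
          ≤ Real.exp (6 * μ) * Real.exp (-(κ * d₀)) * Real.exp (-(μ * (Site.tdist z v : ℝ))) := by
        rw [← Real.exp_nat_mul, ← Real.exp_add, ← Real.exp_add, ← Real.exp_add, Real.exp_le_exp]
        push_cast
        have h1 : κ * d₀ ≤ κ * ((Site.tdist (iterBlockOf (K - n) x₀) z : ℝ) + (Site.tdist z v : ℝ)) := mul_le_mul_of_nonneg_left htri hκ0.le
        have h2 : κ * (Site.tdist z v : ℝ) ≤ μ * (Site.tdist z v : ℝ) := mul_le_mul_of_nonneg_right hκμ hdzy0
        linarith only [h1, h2, hμ, hdzy0]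
      calc 8 * Real.exp (3 * κ) * Real.exp (-(κ * (Site.tdist (iterBlockOf (K - n) x₀) z : ℝ))) * ‖toL2S F K c₀ (fun x => if iterBlockOf (K - n) x = z then u' x else 0)‖ ^ 2
          ≤ 8 * Real.exp (3 * κ) * Real.exp (-(κ * (Site.tdist (iterBlockOf (K - n) x₀) z : ℝ))) * (Real.exp (-(μ * ((Site.tdist z v : ℝ) - 3))) * Cf) ^ 2 :=
            mul_le_mul_of_nonneg_left h2 (by positivity)
        _ = 8 * Real.exp (3 * κ) * Cf ^ 2 * (Real.exp (-(κ * (Site.tdist (iterBlockOf (K - n) x₀) z : ℝ))) * (Real.exp (-(μ * ((Site.tdist z v : ℝ) - 3)))) ^ 2) := by ring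
        _ ≤ 8 * Real.exp (3 * κ) * Cf ^ 2 * (Real.exp (6 * μ) * Real.exp (-(κ * d₀)) * Real.exp (-(μ * (Site.tdist z v : ℝ)))) :=
            mul_le_mul_of_nonneg_left hexp (by positivity)
        _ = _ := by ring
    refine (Finset.sum_le_sum fun z _ => hblk z).trans ?_
    rw [← Finset.mul_sum]
    have hgeo := sum_exp_neg_mul_tdist_coarse_le F (n := n) (K := K) hμ v
    rw [hEW2]
    calc 8 * Real.exp (3 * κ) * Real.exp (6 * μ) * Cf ^ 2 * Real.exp (-(κ * d₀)) * ∑ z : Site (F.P K) (K - n), Real.exp (-(μ * (Site.tdist z v : ℝ)))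
        ≤ 8 * Real.exp (3 * κ) * Real.exp (6 * μ) * Cf ^ 2 * Real.exp (-(κ * d₀)) * (2 * (1 + 1 / μ)) ^ 3 :=
          mul_le_mul_of_nonneg_left hgeo (by positivity)
      _ = _ := by ring
  have hEW : Real.sqrt (∑ yt, c₀ * ‖WL2.equiv ℂ _ W₂ u yt‖ ^ 2 / W yt) ≤ Real.sqrt EW2 := Real.sqrt_le_sqrt hbracket
  -- V3
  have hmain := norm_apply_le_of_kato_member_weighted_of_letter F n K c₀ h U₀ hueq hlam0 hWpos hsup hs0 hdata hWx₀ hEW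
  rw [sum_range_three_inv] at hmain
  -- numerical clean-up: `λ ≥ 1∕2`
  have hinv2 : lam⁻¹ ≤ 2 := by
    rw [inv_le_comm₀ hlam0 (by norm_num)]; linarith only [hlam]
  have hinv0 : 0 ≤ lam⁻¹ := inv_nonneg.mpr hlam0.le
  have hgeom : 1 + lam⁻¹ + lam⁻¹ ^ 2 ≤ 7 := by
    have h4 : lam⁻¹ ^ 2 ≤ 2 ^ 2 := pow_le_pow_left₀ hinv0 hinv2 2
    linarith only [hinv2, h4]
  have hlam3 : (lam ^ 3)⁻¹ ≤ 8 := by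
    rw [inv_le_comm₀ (by positivity) (by norm_num)]
    have : (1 / 2 : ℝ) ^ 3 ≤ lam ^ 3 := pow_le_pow_left₀ (by norm_num) hlam 3
    linarith only [this]
  -- the two terms
  have hterm1 : s * (1 + lam⁻¹ + lam⁻¹ ^ 2) ≤ 14 * (8 * Real.exp (3 * κ) * (Fb + Real.exp (3 * μ) * (pB * Cf))) * Real.exp (-(κ * d₀)) := by
    set A : ℝ := 8 * Real.exp (3 * κ) * (Fb + Real.exp (3 * μ) * (pB * Cf)) * Real.exp (-(κ * d₀)) with hA_def
    have hA : 0 ≤ A := by rw [hA_def]; positivity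
    have hs' : s ≤ 2 * A :=
      calc s = A * lam⁻¹ := by rw [hs, hA_def, div_eq_mul_inv]
        _ ≤ A * 2 := mul_le_mul_of_nonneg_left hinv2 hA
        _ = 2 * A := by ring
    have hG0 : 0 ≤ 1 + lam⁻¹ + lam⁻¹ ^ 2 := by positivity
    calc s * (1 + lam⁻¹ + lam⁻¹ ^ 2) ≤ (2 * A) * (1 + lam⁻¹ + lam⁻¹ ^ 2) := mul_le_mul_of_nonneg_right hs' hG0
      _ ≤ (2 * A) * 7 := mul_le_mul_of_nonneg_left hgeom (by positivity)
      _ = 14 * (8 * Real.exp (3 * κ) * (Fb + Real.exp (3 * μ) * (pB * Cf))) * Real.exp (-(κ * d₀)) := by rw [hA_def]; ring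
  have hterm2 : Real.sqrt (3 ^ 3 / (c₀ * ((F.L : ℝ) ^ (K - n)) ^ 3) * (lam ^ 3)⁻¹) * Real.sqrt EW2
      ≤ (Real.sqrt (3 ^ 3 / (c₀ * ((F.L : ℝ) ^ (K - n)) ^ 3) * 8) *
          Real.sqrt (8 * Real.exp (3 * κ) * Real.exp (6 * μ) * (2 * (1 + 1 / μ)) ^ 3) * Cf) * Real.exp (-(κ / 2 * d₀)) := by
    have hL0 : (0 : ℝ) ≤ 3 ^ 3 / (c₀ * ((F.L : ℝ) ^ (K - n)) ^ 3) := by have := F.hL.2; positivity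
    have h1 : Real.sqrt (3 ^ 3 / (c₀ * ((F.L : ℝ) ^ (K - n)) ^ 3) * (lam ^ 3)⁻¹) ≤ Real.sqrt (3 ^ 3 / (c₀ * ((F.L : ℝ) ^ (K - n)) ^ 3) * 8) :=
      Real.sqrt_le_sqrt (mul_le_mul_of_nonneg_left hlam3 hL0)
    have h2 : Real.sqrt EW2 = Real.sqrt (8 * Real.exp (3 * κ) * Real.exp (6 * μ) * (2 * (1 + 1 / μ)) ^ 3) * Cf * Real.exp (-(κ / 2 * d₀)) := by
      rw [hEW2]
      have e1 : 8 * Real.exp (3 * κ) * Real.exp (6 * μ) * (2 * (1 + 1 / μ)) ^ 3 * Cf ^ 2 * Real.exp (-(κ * d₀))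
          = (8 * Real.exp (3 * κ) * Real.exp (6 * μ) * (2 * (1 + 1 / μ)) ^ 3) * (Cf * Real.exp (-(κ / 2 * d₀))) ^ 2 := by
        rw [mul_pow, mul_pow, ← Real.exp_nat_mul]; push_cast; ring_nf
      rw [e1, Real.sqrt_mul (by positivity), Real.sqrt_sq (by positivity)]; ring
    rw [h2]
    have hB : 0 ≤ Real.sqrt (8 * Real.exp (3 * κ) * Real.exp (6 * μ) * (2 * (1 + 1 / μ)) ^ 3) * Cf * Real.exp (-(κ / 2 * d₀)) := by positivity
    calc _ ≤ Real.sqrt (3 ^ 3 / (c₀ * ((F.L : ℝ) ^ (K - n)) ^ 3) * 8) * (Real.sqrt (8 * Real.exp (3 * κ) * Real.exp (6 * μ) * (2 * (1 + 1 / μ)) ^ 3) * Cf * Real.exp (-(κ / 2 * d₀))) :=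
          mul_le_mul_of_nonneg_right h1 hB
      _ = _ := by ring
  have hfinal := hmain.trans (add_le_add hterm1 hterm2)
  exact hfinal.trans (le_of_eq (by ring))


end Summit.QuantumFields.YangMills.Theorems.Prop7MassiveSolutionPointwiseDecay

end
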